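/-
Copyright (c) 2026 the pub-hodgecm-mathlib formalisation cell (harness21).  Prover seat hodgecm-mathlib-LH4-p02 (g12): STAGE 1a «(D-RAM) FOUR-FRAME» road,
tier-2 support row «BRIDGE-AC» (LEAD F0P3a-plan (g19) T18-02 (2); dealer LH4-plan (g10) WORD #20 (1)); 2026-09-03.
-/
import Mathlib.Topology.Algebra.Valued.ValuedField
import Mathlib.Topology.Algebra.Valued.WithZeroMulInt
import Mathlib.RingTheory.AdicCompletion.Basic
import HarnessLib

/-!
# A complete discretely valued field has an `𝓂`-adically complete valuation ring: `CompleteSpace K ⇒ IsAdicComplete 𝓂[K] 𝒪[K]`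

Topic `NumberTheory/LocalFields`; namespace `Literature.NumberTheory.LocalFields`.  THEOREMS ONLY (no definition, no instance, no notation, no named fact, no
`sorry`).  Cell `pub/hodgecm-mathlib` (D-0151), crux H413 = `stmt-HodgeConjecture-24833`, line LH4 «(D-RAM) FOUR-FRAME», the BRIDGE between the two binder
prefixes of the wild layer: the law ∕ unit modules bind `[CompleteSpace K]` (★ `F0P3cDyRamFourFrameLawDefs`, `U1_Frames`, `U3_Laws`), while the ★ wild norm
surjectivity `Literature.NumberTheory.LocalFields.WildQuadraticDatum.exists_mul_map_eq_of_isRamifiedQuadraticDatum` (p854729) and the U0 module's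
`stub_U0_normSurj_oneUnits_wild` bind `[IsAdicComplete 𝓂[K] 𝒪[K]]` (Hensel-type successive approximation).  This file lets every `[CompleteSpace K]`-bound
payer reach the `IsAdicComplete` layer by one `haveI` — for a `ℤᵐ⁰`-valued field `K` with a uniformizer `ϖ` (`|ϖ| = exp(−1)`), complete for its valuation
uniformity, the valuation ring `𝒪[K] = {|x| ≤ 1}` is `𝓂[K]`-adically complete.

* §1 `v_lt_one_iff_v_le_of_v_eq` (`|x| < 1 ↔ |x| ≤ |ϖ|` in the discrete value group), `maximalIdeal_eq_span_of_v_eq` (`𝓂[K] = (ϖ)`),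
  `mem_maximalIdeal_pow_iff_of_v_eq` (`x ∈ 𝓂ⁿ ↔ |x| ≤ |ϖⁿ|`).
* §2 **`isAdicComplete_valuedInteger_of_completeSpace`** (the dealt text VERBATIM): Hausdorff — `|x| ≤ |ϖ|ⁿ` for all `n` forces `x = 0`; precomplete — a
  sequence Cauchy for `(𝓂ⁿ)` is Cauchy in `K` (`|ϖⁿ| → 0`), converges in the complete `K`, the limit lies in the closed ball `𝒪[K]` and in each closed ball
  `f n + 𝓂ⁿ` (the proof of ★ `IsDedekindDomain.HeightOneSpectrum.adicCompletionIntegers.isAdicComplete`, `Literature/RingTheory/DiscreteValuationRing/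
  AdicCompletionHensel.lean`, transplanted from `K_v` to an abstract complete `K`; Mathlib proves this only for `IsNonarchimedeanLocalField`).
HONEST LABEL: unconditional local algebra, count-neutral (`--supports stmt-HodgeConjecture-24833`); HC_CM is proved only modulo the 7 printed citations (2 remaining:
hLiu418 24832, h413 24833) until rung 0 closes.

## References
* [Serre1979] J.-P. Serre, *Local Fields*, GTM 67 (1979), Ch. II §1 (`A = lim A∕𝔪ⁿ` for a complete discrete valuation ring; `𝔪ⁿ = (πⁿ)`).
* [NeukirchANT1999] J. Neukirch, *Algebraic Number Theory*, Grundlehren 322 (1999), Ch. II (4.5) (`𝒪 ≅ lim 𝒪∕𝔭ⁿ` for the valuation ring of a complete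
  discretely valued field).

## Tree search
`lean search 'isAdicComplete_valuedInteger|IsAdicComplete 𝓂'`: Mathlib has no `CompleteSpace K → IsAdicComplete 𝓂[K] 𝒪[K]` for a general `Valued K ℤᵐ⁰`
(only inside `IsNonarchimedeanLocalField`, via compactness of `𝒪[K]`); the tree has the `K_v = v.adicCompletion K` instance ★ `adicCompletionIntegers.isAdicComplete`
and the normed twin ★ `Literature.NumberTheory.GaloisRepresentations.Ultrametric.isAdicComplete_integer` (`[ProperSpace F]`) — both cited as the proof pattern,
neither importable at the abstract `Valued` binder the wild layer uses.  Mathlib inputs: `Valuation.Integer.not_isUnit_iff_valuation_lt_one`,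
`Valuation.Integers.le_iff_dvd`, `Ideal.span_singleton_pow`, `Valued.hasBasis_uniformity`, `Valued.hasBasis_nhds_zero`, `Valued.tendsto_zero_pow_of_v_lt_one`,
`Valued.isClosed_integer`, `Valued.isClosed_closedBall`, `cauchySeq_tendsto_of_complete`.
-/

namespace Literature.NumberTheory.LocalFields

open scoped Valued
open Filter _root_.Topology WithZero

variable {K : Type*} [Field K] [Valued K ℤᵐ⁰]

/-! ## §1 The powers of the maximal ideal of `𝒪[K]` read through the valuation -/

/-- `|x| < 1 ↔ |x| ≤ |ϖ|` for a uniformizer `ϖ` (`|ϖ| = exp(−1)`): the value group is `ℤ`. [cite: Serre1979, Ch. II §1] -/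
theorem v_lt_one_iff_v_le_of_v_eq {ϖ : K} (hϖ : Valued.v ϖ = exp (-1 : ℤ)) (x : K) :
    Valued.v x < 1 ↔ Valued.v x ≤ Valued.v ϖ := by
  rw [hϖ]
  constructor
  · intro hx
    by_cases h0 : Valued.v x = 0
    · rw [h0]; exact zero_le
    · rw [← exp_log h0, ← exp_zero, exp_lt_exp] at hx
      rw [← exp_log h0, exp_le_exp]
      omega
  · intro hx
    exact hx.trans_lt (by rw [← exp_zero, exp_lt_exp]; norm_num)

/-- **`𝓂[K] = (ϖ)`**: the maximal ideal of the valuation ring is generated by any uniformizer. [cite: Serre1979, Ch. II §1] -/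
theorem maximalIdeal_eq_span_of_v_eq {ϖ : 𝒪[K]} (hϖ : Valued.v (ϖ : K) = exp (-1 : ℤ)) : 𝓂[K] = Ideal.span {ϖ} := by
  have hv : Valued.v.Integers 𝒪[K] := Valuation.integer.integers _
  ext x
  rw [Valued.maximalIdeal, IsLocalRing.mem_maximalIdeal, mem_nonunits_iff, Valuation.Integer.not_isUnit_iff_valuation_lt_one,
    v_lt_one_iff_v_le_of_v_eq hϖ, Ideal.mem_span_singleton, ← hv.le_iff_dvd]
  rfl

/-- **`x ∈ 𝓂[K]ⁿ ↔ |x| ≤ |ϖⁿ|`** (`𝓂ⁿ = (ϖⁿ)`, and divisibility in the valuation ring is comparison of valuations). [cite: Serre1979, Ch. II §1] -/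
theorem mem_maximalIdeal_pow_iff_of_v_eq {ϖ : 𝒪[K]} (hϖ : Valued.v (ϖ : K) = exp (-1 : ℤ)) (n : ℕ) (x : 𝒪[K]) :
    x ∈ 𝓂[K] ^ n ↔ Valued.v (x : K) ≤ Valued.v ((ϖ : K) ^ n) := by
  have hv : Valued.v.Integers 𝒪[K] := Valuation.integer.integers _
  rw [maximalIdeal_eq_span_of_v_eq hϖ, Ideal.span_singleton_pow, Ideal.mem_span_singleton, ← hv.le_iff_dvd]
  rfl

/-! ## §2 The bridge `CompleteSpace K ⇒ IsAdicComplete 𝓂[K] 𝒪[K]` -/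

/-- **THE VALUATION RING OF A COMPLETE DISCRETELY VALUED FIELD IS `𝓂`-ADICALLY COMPLETE** (`𝒪 = lim 𝒪∕𝓂ⁿ`): for a `ℤᵐ⁰`-valued field `K` with a
uniformizer `ϖ` (`|ϖ| = exp(−1)`), complete for the valuation uniformity, `IsAdicComplete 𝓂[K] 𝒪[K]`.  Hausdorff: `|x| ≤ |ϖ|ⁿ` for every `n` forces `x = 0`;
precomplete: a sequence in `𝒪[K]` which is Cauchy for the filtration `(𝓂ⁿ)` is Cauchy in `K` (`|ϖⁿ| → 0`), converges in the complete `K`, its limit lies in the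
closed ball `𝒪[K]` and in each closed ball `f n + 𝓂ⁿ`. [cite: Serre1979, Ch. II §1] [cite: NeukirchANT1999, Ch. II (4.5)] -/
theorem isAdicComplete_valuedInteger_of_completeSpace {K : Type*} [Field K] [Valued K ℤᵐ⁰] [CompleteSpace K] {ϖ : K}
    (hϖ : Valued.v ϖ = WithZero.exp (-1 : ℤ)) : IsAdicComplete 𝓂[K] 𝒪[K] := by
  have hϖ1 : Valued.v ϖ < 1 := by rw [hϖ, ← exp_zero, exp_lt_exp]; norm_num
  have hϖint : ϖ ∈ 𝒪[K] := (Valuation.mem_integer_iff _ _).2 hϖ1.le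
  have hmem : ∀ (n : ℕ) (x : 𝒪[K]), x ∈ 𝓂[K] ^ n • (⊤ : Ideal 𝒪[K]) ↔ Valued.v (x : K) ≤ Valued.v (ϖ ^ n) := by
    intro n x
    rw [smul_eq_mul, Ideal.mul_top, mem_maximalIdeal_pow_iff_of_v_eq (ϖ := ⟨ϖ, hϖint⟩) hϖ]
  refine { haus' := fun x hx => ?_, prec' := fun f hf => ?_ }
  · -- Hausdorff
    have hx' : ∀ n : ℕ, Valued.v (x : K) ≤ Valued.v (ϖ ^ n) := fun n => by
      have h := hx n
      rw [SModEq.zero, hmem] at h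
      exact h
    apply Subtype.ext
    show (x : K) = 0
    by_contra h0
    have hv0 : Valued.v (x : K) ≠ 0 := (Valuation.ne_zero_iff _).2 h0
    obtain ⟨m, hm⟩ : ∃ m : ℤ, Valued.v (x : K) = exp m := ⟨_, (exp_log hv0).symm⟩
    have h := hx' ((-m).toNat + 1)
    rw [map_pow, hϖ, ← exp_nsmul, hm, exp_le_exp, smul_neg, nsmul_eq_mul, mul_one] at h
    omega
  · -- precomplete
    simp only [SModEq.sub_mem, hmem, AddSubgroupClass.coe_sub] at hf ⊢
    set g : ℕ → K := fun n => (f n : K) with hg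
    have hpow : Tendsto (fun n : ℕ => ϖ ^ n) atTop (𝓝 0) := Valued.tendsto_zero_pow_of_v_lt_one hϖ1
    have hbound : ∀ {N k : ℕ}, N ≤ k → Valued.v.restrict (g k - g N) ≤ Valued.v.restrict (ϖ ^ N) := by
      intro N k hk
      rw [Valuation.restrict_le_iff, Valuation.map_sub_swap]
      exact hf hk
    have hcauchy : CauchySeq g := by
      rw [(Valued.hasBasis_uniformity K _).cauchySeq_iff]
      intro γ _
      have hev := (Valued.hasBasis_nhds_zero K _).tendsto_right_iff.mp hpow γ trivial
      obtain ⟨N, hN⟩ := eventually_atTop.mp hev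
      refine ⟨N, fun m hm n hn => ?_⟩
      show Valued.v.restrict (g n - g m) < γ.1
      calc Valued.v.restrict (g n - g m)
          = Valued.v.restrict ((g n - g N) - (g m - g N)) := by rw [sub_sub_sub_cancel_right]
        _ ≤ max (Valued.v.restrict (g n - g N)) (Valued.v.restrict (g m - g N)) := Valuation.map_sub _ _ _
        _ ≤ Valued.v.restrict (ϖ ^ N) := max_le (hbound hn) (hbound hm)
        _ < γ.1 := hN N le_rfl
    obtain ⟨L, hL⟩ := cauchySeq_tendsto_of_complete hcauchy
    -- the limit lies in the closed subring `𝒪[K]`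
    have hLmem : L ∈ 𝒪[K] :=
      (Valued.isClosed_integer K).mem_of_tendsto hL (Eventually.of_forall fun n => (f n).2)
    refine ⟨⟨L, hLmem⟩, fun n => ?_⟩
    -- and in each closed ball `f n + 𝓂ⁿ`
    have hclosed : IsClosed {y : K | Valued.v (y - g n) ≤ Valued.v (ϖ ^ n)} := by
      have h1 : IsClosed {y : K | Valued.v.restrict y ≤ Valued.v.restrict (ϖ ^ n)} := Valued.isClosed_closedBall _ _
      simp only [Valuation.restrict_le_iff] at h1
      exact h1.preimage (continuous_sub_right (g n))
    have hLball : L ∈ {y : K | Valued.v (y - g n) ≤ Valued.v (ϖ ^ n)} :=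
      hclosed.mem_of_tendsto hL (eventually_atTop.mpr ⟨n, fun k hk => by
        show Valued.v (g k - g n) ≤ _
        rw [Valuation.map_sub_swap]
        exact hf hk⟩)
    rw [Valuation.map_sub_swap]
    exact hLball

end Literature.NumberTheory.LocalFields
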